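import Summits.BirchSwinnertonDyer.BirchSwinnertonDyer.Theorems.ThetaPartnerAtTwoSignedMainConjectureCMTwoRankZeroPTDeepTransferTools
import Summits.BirchSwinnertonDyer.BirchSwinnertonDyer.Theorems.ResidualThetaTransportAtTwoResidualSignedLambdaLowerCMAtTwoCoindShapiroOfFun
import Summits.BirchSwinnertonDyer.Rank1Residual.X1.LocalKerOverAtPConj
import Summits.BirchSwinnertonDyer.Rank1Residual.Additive.GreenbergKummerTameDescent
import Literature.NumberTheory.EllipticCurves.Greenberg1999.KernelOfReductionLocalDatumTorsion
import Literature.NumberTheory.EllipticCurves.KummerImageOfFormalGroupH1TrivialProofs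
import Literature.NumberTheory.EllipticCurves.CoatesGreenberg1996.GoodModelKernelH1OfDeeplyRamifiedProofs
import HarnessLib

set_option linter.dupNamespace false -- `…BirchSwinnertonDyer.BirchSwinnertonDyer…` is the cell's nested layout (D-0017)
set_option autoImplicit false

/-!
# H46 kernel programme (road C′), the socket at `p`, STRICT side: Greenberg's strict condition `C_p[p^k]` on a layer class is
# KUMMER over `ℚ_∞` (every conjugate), and it is what the primal local condition `Lp` of the levelwise Poitou–Tate call says

Cell `bsd-2adic` (run/shared/lean/pub/bsd-2adic/), seat `bsd-2adic-tower-1` GEN 35; `--supports stmt-BirchSwinnertonDyer-19271`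
(helper, item `OrdKatoHalfAtTwo`, TOWER road). THEOREMS ONLY (no definition, no named fact, no instance, no `sorry`); closes no item;
nothing booked; BSD is not proved by any of this.

Context. GEN 34 reduced Greenberg's Lemma 4.6 on `Γ`-invariants (`Greenberg1999.lemma46_gammaInvariants_auxPlace_rat`, the one print
input of the tree's Thm-4.1-with-torsion column) to `TorsionEulerChar.H46Assembly.exists_realiser_of_sockets` (p735305) modulo two
sockets. The socket **(HP)** at the place `p` consists of a primal local condition `Lp` on `H¹(ℚ_p, Maps(Γ_ℚ ⧸ Γ_n, E[p^k]))`, a predicate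
`Λp` on layer classes `H¹(Γ_n, E[p^k])`, `hLdual` (dual classes orthogonal to `Lp` satisfy `Λp`) and `hP` (a primal class with
`loc_p(Sh c) ∈ Lp` has a realiser `T(c) = res_{Γ_n → Γ_∞}(push c)` that is KUMMER above `p`, every conjugate). This file fixes

  `Λp p b := b ∈ (W.kernelOfReductionLocalDatumTorsion (p^k) p).strictKer Γ_n`   (Greenberg's STRICT condition for `C_p[p^k] = E[p^k] ∩ E₁`,
  the finite-level datum p731663), and
  `Lp p := pull_p⁻¹ ( Sh_loc ( ker (H¹(U_n, E[p^k]|) → H¹(U_n, E[p^k]| ⧸ C_p[p^k])) ) )`   (the LAYER-local strict classes, in the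
  one-orbit Shapiro dictionary of `ThetaTransport.CoindShapiroOfFun`: `pull_p ∘ loc_p ∘ Sh = Sh_loc ∘ loc_n`),

spelled with EXISTING constructions only (`ContinuousRep.quotient` / `ContinuousRep.mkQHom` of the restricted module
`GaloisRep.restrictField ℚ_p E[p^k]` by `C_p[p^k]`, `coindFinPull`, `CyclotomicLayer.layerShapiroOf` / `layerLocOf`), and proves:

* §1 `plus_toIntSubmodule_le_comap` — `C_p[p^k]` is `Γ_{ℚ_p}`-stable (input of the quotient construction);
* §2 `push_mem_strictKer_of_mem_strictKer` — STRICT at level `E[p^k]` ⟹ STRICT at level `E[p^∞]` for the pushed class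
  (`inclusion_mem_kernelOfReductionLocalDatum_plus_iff`);
* §3 **`conjH1_realiser_mem_localKerOver_of_mem_strictKer`** — `Λp p c` ⟹ `∀ σ, conj_σ T(c) ∈ W.localKerOver p κ.kerSubgroup ℚ_p`:
  restriction to `Γ_∞` keeps strictness (`TameDescent.resOfLe_mem_strictKer`), strict ⟹ Kummer over `ℚ_∞` at a good `p` is the KERNEL
  theorem `strictKer_kernelOfReductionLocalDatum_le_localKerOver_of_H1_formalGroup_trivial` fed the KERNEL Coates–Greenberg fact
  `WeierstrassCurve.CoatesGreenberg1996_H1_formalGroup_trivial_holds` (deeply ramified tower; NO ordinarity needed here), and the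
  conjugates by `X1.LocalKerOverAtPConj.conjH1_mem_localKerOver_of_mem` (`Γ_ℚ = D_p · Γ_∞`, `p` totally ramified in the cyclotomic tower);
* §4 `mem_strictKer_of_cohomologyMap_mkQHom_layerLocOf_eq_zero` — the dictionary «`loc_n c ↦ 0` in `H¹(U_n, E[p^k]| ⧸ C_p[p^k])` ⟹
  `c ∈ strictKer Γ_n`» (cocycle criterion `mem_strictKer_iff_exists_gr`; `U_n = localSubgroup Γ_n ℚ_p`, `D_p = range res`);
* §5 **`conjH1_realiser_mem_localKerOver_of_localization_shapiroLift_mem`** — the socket's `hP`: `loc_p(Sh c) ∈ Lp p` ⟹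
  `∀ σ, conj_σ T(c) ∈ localKerOver` (RTT `cohomologyMap_coindFinPull_localization_shapiroLift` + `shapiroLift_injective` + §4 + §3).

The dual half `hLdual` (Lagrangian ⟹ self-annihilating, where ORDINARITY enters as `#C_p[p^k] = p^k`) is the sibling file
`…TorsionEulerCharH46AtPDual.lean`. HONEST FRAMING: plumbing over tree theorems; H46 is not proved in this file; BSD is not proved by any
of this.

References: [GreenbergLNM1716] §2 Prop. 2.4 (pp. 74–75, 79–80), p. 83, §4 Lemma 4.6 (p. 105); [Greenberg1989] §1 p. 98 (strict condition);
[CoatesGreenberg1996] Cor. 3.2, Prop. 4.3; [NeukirchSchmidtWingberg2008] I §6 (1.6.4)–(1.6.5) (Shapiro, one orbit).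
-/

noncomputable section

open scoped Classical NumberField

namespace Summit.BirchSwinnertonDyer.BirchSwinnertonDyer.Theorems

namespace TorsionEulerChar.H46AtP

open CategoryTheory Field NumberField IsDedekindDomain WeierstrassCurve
  Literature.NumberTheory.EllipticCurves Literature.NumberTheory.EllipticCurves.CyclotomicLayer
  Literature.NumberTheory.EllipticCurves.GreenbergSelmer
  Literature.NumberTheory.GaloisRepresentations Literature.NumberTheory.GaloisRepresentations.DiscreteGaloisModule
  Literature.NumberTheory.GaloisCohomology ZpExtension
open _root_.TopRep _root_.ContinuousCohomology

/-! ## §1 `C_v[m]` is `Γ_{K_v}`-stable inside the restricted module `E[m]|` -/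

section Stable

variable {K : Type} [Field K] [NumberField K] (W : WeierstrassCurve K) (m : ℤ) (v : HeightOneSpectrum (𝓞 K))

/-- `C_v[m] = E[m] ∩ E₁(K̄_v)`, as a `ℤ`-submodule of `E[m]`, is stable under every `σ ∈ Γ_{K_v}` acting through `res : Γ_{K_v} → Γ_K`
(`LocalDatum.smul_mem` of the datum p731663) — the hypothesis of `ContinuousRep.quotient` / `ContinuousRep.subrepresentation` for the
restricted module `GaloisRep.restrictField K_v (W.torsionGaloisModule m)`. [cite: GreenbergLNM1716, §2 p. 73 (C_v is G_{F_v}-invariant)] -/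
theorem plus_toIntSubmodule_le_comap (g : absoluteGaloisGroup (v.adicCompletion K)) :
    AddSubgroup.toIntSubmodule (W.kernelOfReductionLocalDatumTorsion m v).plus ≤
      (AddSubgroup.toIntSubmodule (W.kernelOfReductionLocalDatumTorsion m v).plus).comap
        ((GaloisRep.restrictField (v.adicCompletion K) (W.torsionGaloisModule m)) g) := by
  intro P hP
  rw [Submodule.mem_comap]
  exact (W.kernelOfReductionLocalDatumTorsion m v).smul_mem g hP

end Stable

/-! ## §2 Strict at level `E[p^k]` ⟹ strict at level `E[p^∞]` for the pushed class -/

section Push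

variable {K : Type} [Field K] [NumberField K] (W : WeierstrassCurve K) (p : ℕ)
  (H : Subgroup (absoluteGaloisGroup K)) (v : HeightOneSpectrum (𝓞 K)) (k : ℕ)

/-- **STRICT at `E[p^k]` ⟹ STRICT at `E[p^∞]`.** If a class `c ∈ H¹(H, E[p^k])` dies in `H¹(H ⊓ D_v, E[p^k] ⧸ C_v[p^k])`, its push-forward
along `E[p^k] ↪ E[p^∞]` (TP2 spelling) dies in `H¹(H ⊓ D_v, E[p^∞] ⧸ C_v)` — the quotient maps are compatible because both data read
«`ι P ∈ E₁(K̄_v)`» (`inclusion_mem_kernelOfReductionLocalDatum_plus_iff`). [cite: GreenbergLNM1716, §2 p. 73] [cite: Greenberg1989, §1 p. 98] -/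
theorem push_mem_strictKer_of_mem_strictKer (c : W.torsionH1Over ((p : ℤ) ^ k) H)
    (hc : c ∈ (W.kernelOfReductionLocalDatumTorsion ((p : ℤ) ^ k) v).strictKer H) :
    resH1Hom (N := W.geomPrimaryTorsion p) (subgroupInclusion (le_refl H))
        (AddSubgroup.inclusion (AcSigned.geomTorsion_zpow_le_geomPrimaryTorsion W p k)) (fun _ _ ↦ rfl) c ∈
      (W.kernelOfReductionLocalDatum p v).strictKer H := by
  obtain ⟨f, rfl⟩ := oneCocycleClass_surjective (discreteTopRep H (W.geomTorsion ((p : ℤ) ^ k))) c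
  obtain ⟨q, hq⟩ :=
    (mem_strictKer_iff_exists_gr H _ (W.kernelOfReductionLocalDatumTorsion ((p : ℤ) ^ k) v) f).1 hc
  obtain ⟨m, rfl⟩ := (W.kernelOfReductionLocalDatumTorsion ((p : ℤ) ^ k) v).grMk_surjective q
  rw [resH1Hom_oneCocycleClass]
  refine (mem_strictKer_iff_exists_gr H _ (W.kernelOfReductionLocalDatum p v) _).2
    ⟨(W.kernelOfReductionLocalDatum p v).grMk
      (AddSubgroup.inclusion (AcSigned.geomTorsion_zpow_le_geomPrimaryTorsion W p k) m), fun x ↦ ?_⟩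
  have h := hq x
  rw [Subgroup.smul_def, LocalDatum.smul_grMk, ← map_sub, ← sub_eq_zero, ← map_sub, ← AddMonoidHom.mem_ker,
    LocalDatum.ker_grMk] at h
  rw [Subgroup.smul_def, LocalDatum.smul_grMk, ← map_sub, ← sub_eq_zero, ← map_sub, ← AddMonoidHom.mem_ker,
    LocalDatum.ker_grMk]
  have key : (contOneCocycles.pullback (subgroupInclusion (le_refl H))
        (resHomOfEquivariant (subgroupInclusion (le_refl H))
          (AddSubgroup.inclusion (AcSigned.geomTorsion_zpow_le_geomPrimaryTorsion W p k)) (fun _ _ ↦ rfl)) f).1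
          (decompInToH H v x) -
        (((x : decomp (K := K) v) : absoluteGaloisGroup K) •
            AddSubgroup.inclusion (AcSigned.geomTorsion_zpow_le_geomPrimaryTorsion W p k) m -
          AddSubgroup.inclusion (AcSigned.geomTorsion_zpow_le_geomPrimaryTorsion W p k) m) =
      AddSubgroup.inclusion (AcSigned.geomTorsion_zpow_le_geomPrimaryTorsion W p k)
        (f.1 (decompInToH H v x) - (((x : decomp (K := K) v) : absoluteGaloisGroup K) • m - m)) := by
    apply Subtype.ext
    simp only [map_sub, AddSubgroup.coe_inclusion, AddSubgroupClass.coe_sub,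
      Literature.NumberTheory.EllipticCurves.primaryComponent.coe_smul,
      Literature.NumberTheory.EllipticCurves.AddSubgroup.torsionBy.coe_smul]
    rfl
  rw [key, WeierstrassCurve.inclusion_mem_kernelOfReductionLocalDatum_plus_iff]
  exact h

end Push

/-! ## §3 `Λp` (strict at level `E[p^k]`, layer `Γ_n`) ⟹ the realiser `T(c)` is Kummer above `p` over `ℚ_∞`, every conjugate -/

section Kummer

variable (W : WeierstrassCurve ℚ) [W.IsElliptic] (p : ℕ) [Fact p.Prime] (κ : ZpExtension ℚ p) (hκ : κ.IsCyclotomic) (n k : ℕ)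
  (v : HeightOneSpectrum (𝓞 ℚ)) (hpv : ((p : ℕ) : 𝓞 ℚ) ∈ v.asIdeal) (hgood : W.HasGoodReductionAt v)

include hκ hpv hgood in
/-- **`Λp ⟹ Kummer` (every conjugate).** For `W/ℚ`, `p` a prime of GOOD reduction, `κ` the cyclotomic `ℤ_p`-extension and a layer class
`c ∈ H¹(Γ_n, E[p^k])` that is STRICT at `p` for `C_p[p^k]`: the realiser `T(c) := res_{Γ_n → Γ_∞}(push c) ∈ H¹(ℚ_∞, E[p^∞])` satisfies the
Kummer condition above `p` for every conjugate: `conj_σ T(c) ∈ W.localKerOver p κ.kerSubgroup ℚ_p`. Steps: §2 (push), `TameDescent.resOfLe_mem_strictKer`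
(restrict to `Γ_∞`), the KERNEL `Im λ ⊆ Im κ` over `ℚ_∞` (`strictKer_kernelOfReductionLocalDatum_le_localKerOver_of_H1_formalGroup_trivial` with
`WeierstrassCurve.CoatesGreenberg1996_H1_formalGroup_trivial_holds`), and `X1.LocalKerOverAtPConj.conjH1_mem_localKerOver_of_mem` for the conjugates
(`Γ_ℚ = res(Γ_{ℚ_p}) · Γ_∞`: `p` is totally ramified in `ℚ_∞`). No ordinarity is used. [cite: GreenbergLNM1716, §2 Prop. 2.4 (pp. 79–80), p. 83]
[cite: CoatesGreenberg1996, Cor. 3.2] -/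
theorem conjH1_realiser_mem_localKerOver_of_mem_strictKer (c : W.torsionH1Over ((p : ℤ) ^ k) (κ.layerSubgroup n))
    (hc : c ∈ (W.kernelOfReductionLocalDatumTorsion ((p : ℤ) ^ k) v).strictKer (κ.layerSubgroup n)) (σ : absoluteGaloisGroup ℚ) :
    W.conjH1 p κ.kerSubgroup σ (W.layerToInfty κ n
        (resH1Hom (N := W.geomPrimaryTorsion p) (subgroupInclusion (le_refl (κ.layerSubgroup n)))
          (AddSubgroup.inclusion (AcSigned.geomTorsion_zpow_le_geomPrimaryTorsion W p k)) (fun _ _ ↦ rfl) c)) ∈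
      W.localKerOver p κ.kerSubgroup (v.adicCompletion ℚ) := by
  refine Summit.BirchSwinnertonDyer.Rank1Residual.X1.LocalKerOverAtPConj.conjH1_mem_localKerOver_of_mem (W := W) (p := p) (κ := κ)
    hκ hpv ?_ σ
  have hpush := push_mem_strictKer_of_mem_strictKer W p (κ.layerSubgroup n) v k c hc
  have hres : W.layerToInfty κ n
      (resH1Hom (N := W.geomPrimaryTorsion p) (subgroupInclusion (le_refl (κ.layerSubgroup n)))
        (AddSubgroup.inclusion (AcSigned.geomTorsion_zpow_le_geomPrimaryTorsion W p k)) (fun _ _ ↦ rfl) c) ∈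
      (W.kernelOfReductionLocalDatum p v).strictKer κ.kerSubgroup :=
    Summit.BirchSwinnertonDyer.Rank1Residual.Additive.TameDescent.resOfLe_mem_strictKer W p
      (W.kernelOfReductionLocalDatum p v) (κ.kerSubgroup_le_layerSubgroup n) hpush
  exact strictKer_kernelOfReductionLocalDatum_le_localKerOver_of_H1_formalGroup_trivial W p κ v
    WeierstrassCurve.CoatesGreenberg1996_H1_formalGroup_trivial_holds hκ hpv hgood hres

end Kummer

/-! ## §4 The layer dictionary: «`loc_n c ↦ 0` in `H¹(U_n, E[m]| ⧸ C_v[m])`» ⟹ `c ∈ strictKer Γ_n` -/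

section Dictionary

variable (W : WeierstrassCurve ℚ) (m : ℤ) {p : ℕ} [Fact p.Prime] (κ : ZpExtension ℚ p) (n : ℕ)
  (v : HeightOneSpectrum (𝓞 ℚ))

/-- **Layer dictionary for the strict condition.** For a layer class `c ∈ H¹(Γ_n, E[m])`: if its layer localisation
`loc_n c ∈ H¹(U_n, E[m]|)` (`layerLocOf`, `U_n = localSubgroup Γ_n ℚ_v ≤ Γ_{ℚ_v}`) dies in `H¹(U_n, E[m]| ⧸ C_v[m])` (quotient module
`ContinuousRep.quotient` of the restricted module by the `Γ_{ℚ_v}`-stable `C_v[m]`, map `ContinuousRep.mkQHom`), then `c` is STRICT at `v`: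
`c ∈ (W.kernelOfReductionLocalDatumTorsion m v).strictKer Γ_n` — every element of `Γ_n ⊓ D_v` is `res τ` with `τ ∈ U_n`, and both quotient
maps are `E[m] → E[m] ⧸ C_v[m]` with the action through `res` (cocycle criteria `oneCocycleClass_eq_zero_iff`, `mem_strictKer_iff_exists_gr`).
[cite: Greenberg1989, §1 p. 98] [cite: NeukirchSchmidtWingberg2008, I §6 (1.6.5)] -/
theorem mem_strictKer_of_cohomologyMap_mkQHom_layerLocOf_eq_zero (c : W.torsionH1Over m (κ.layerSubgroup n))
    (h0 : cohomologyMap (subgroupRepMap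
        (ContinuousRep.mkQHom (GaloisRep.restrictField (v.adicCompletion ℚ) (W.torsionGaloisModule m))
          (AddSubgroup.toIntSubmodule (W.kernelOfReductionLocalDatumTorsion m v).plus)
          (plus_toIntSubmodule_le_comap W m v)) (layerGroup κ v n)) 1
        (layerLocOf (W.torsionGaloisModule m) κ v n c) = 0) :
    c ∈ (W.kernelOfReductionLocalDatumTorsion m v).strictKer (κ.layerSubgroup n) := by
  obtain ⟨f, rfl⟩ := oneCocycleClass_surjective (discreteTopRep (κ.layerSubgroup n) (W.geomTorsion m)) c
  -- unfold the layer localisation and the quotient map on the explicit cocycle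
  have hloc : layerLocOf (W.torsionGaloisModule m) κ v n
      (oneCocycleClass (discreteTopRep (κ.layerSubgroup n) (W.geomTorsion m)) f) =
      oneCocycleClass _ (contOneCocycles.pullback (resGalSubgroupOfEmb (κ.layerSubgroup n) (closureEmb (K := ℚ) (v.adicCompletion ℚ)))
        (X := subgroupRep (W.torsionGaloisModule m).toTopRep (κ.layerSubgroup n))
        (Y := subgroupRep (localRepOf (W.torsionGaloisModule m) v) (layerGroup κ v n))
        (TopRep.ofHom ⟨ContinuousLinearMap.id ℤ (W.geomTorsion m), fun _ => rfl⟩) f) :=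
    map_oneCocycleClass _ _ _ f
  rw [hloc, cohomologyMap_oneCocycleClass, oneCocycleClass_eq_zero_iff] at h0
  obtain ⟨q, hq⟩ := h0
  obtain ⟨y, rfl⟩ := (W.kernelOfReductionLocalDatumTorsion m v).grMk_surjective q
  refine (mem_strictKer_iff_exists_gr (κ.layerSubgroup n) _ (W.kernelOfReductionLocalDatumTorsion m v) f).2
    ⟨(W.kernelOfReductionLocalDatumTorsion m v).grMk y, fun x ↦ ?_⟩
  -- `x ∈ Γ_n ⊓ D_v` is `res τ` for some `τ ∈ U_n`
  obtain ⟨τ, hτ⟩ := (mem_decomp_iff v _).1 (x : decomp (K := ℚ) v).2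
  have hτU : τ ∈ layerGroup κ v n := by
    rw [mem_localSubgroupOfEmb_iff]
    change absGaloisRestrict ℚ (v.adicCompletion ℚ) τ ∈ κ.layerSubgroup n
    rw [hτ]
    exact (mem_decompIn_iff (κ.layerSubgroup n) v x).1 x.2
  have hx : decompInToH (κ.layerSubgroup n) v x =
      resGalSubgroupOfEmb (κ.layerSubgroup n) (closureEmb (K := ℚ) (v.adicCompletion ℚ)) ⟨τ, hτU⟩ :=
    Subtype.ext hτ.symm
  have h := hq ⟨τ, hτU⟩
  -- both sides are classes of `E[m] ⧸ C_v[m]`, the actions go through `res τ = x`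
  rw [hx, Subgroup.smul_def, LocalDatum.smul_grMk, ← hτ]
  exact h

end Dictionary

/-! ## §5 The socket's `hP`: `loc_p (Sh c) ∈ Lp p` ⟹ every conjugate of the realiser is Kummer above `p` -/

section HP

variable (W : WeierstrassCurve ℚ) [W.IsElliptic] (p : ℕ) [Fact p.Prime] (κ : ZpExtension ℚ p) (hκ : κ.IsCyclotomic) (n k : ℕ)
  [Fintype (absoluteGaloisGroup ℚ ⧸ κ.layerSubgroup n)]
  {s : absoluteGaloisGroup ℚ ⧸ κ.layerSubgroup n → absoluteGaloisGroup ℚ}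
  (hs : ∀ x : absoluteGaloisGroup ℚ ⧸ κ.layerSubgroup n, (s x : absoluteGaloisGroup ℚ ⧸ κ.layerSubgroup n) = x)
  (hs1 : s ((1 : absoluteGaloisGroup ℚ) : absoluteGaloisGroup ℚ ⧸ κ.layerSubgroup n) = 1)
  (v : HeightOneSpectrum (𝓞 ℚ)) (hpv : ((p : ℕ) : 𝓞 ℚ) ∈ v.asIdeal) (hgood : W.HasGoodReductionAt v)

include hκ hpv hgood in
/-- **Socket (HP), the primal half `hP`.** `K = ℚ`, `p` of GOOD reduction, `κ` cyclotomic, `M = E[p^k]` (`W.torsionGaloisModule ((p:ℤ)^k)`),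
`Γ_n = κ.layerSubgroup n`, `U_n = layerGroup κ p n`, `Q = M| ⧸ C_p[p^k]` (`ContinuousRep.quotient`), and the PRIMAL LOCAL CONDITION

  `Lp p = comap pull_p (map Sh_loc (ker (H¹(U_n, M|) → H¹(U_n, Q))))`

(`pull_p = H¹(coindFinPull)`, `Sh_loc = layerShapiroOf`). If `loc_p (Sh c) ∈ Lp p` for a layer class `c ∈ H¹(Γ_n, M)`, then
`conj_σ T(c) ∈ W.localKerOver p κ.kerSubgroup ℚ_p` for every `σ ∈ Γ_ℚ`, `T(c) = res_{Γ_n→Γ_∞}(push c)` (the realiser of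
`exists_realiser_of_sockets`). Proof: `pull_p (loc_p (Sh c)) = Sh_loc (loc_n c)` (RTT `cohomologyMap_coindFinPull_localization_shapiroLift`),
`Sh_loc` injective (`shapiroLift_injective`) ⟹ `loc_n c` dies in `H¹(U_n, Q)` ⟹ §4 ⟹ §3.
[cite: GreenbergLNM1716, §2 Prop. 2.4, §4 Lemma 4.6 (p. 105)] [cite: NeukirchSchmidtWingberg2008, I §6 (1.6.4)–(1.6.5)] -/
theorem conjH1_realiser_mem_localKerOver_of_localization_shapiroLift_mem [CompactSpace (absoluteGaloisGroup ℚ)]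
    [CompactSpace (absoluteGaloisGroup (v.adicCompletion ℚ))] (c : W.torsionH1Over ((p : ℤ) ^ k) (κ.layerSubgroup n))
    (hc : galoisCohomology.localization ((W.torsionGaloisModule ((p : ℤ) ^ k)).coind (κ.layerSubgroup n) (κ.isOpen_layerSubgroup n))
        (Sum.inr v) 1
        (shapiroLift (W.torsionGaloisModule ((p : ℤ) ^ k)).toTopRep (κ.layerSubgroup n) (κ.isOpen_layerSubgroup n) hs hs1 c) ∈
      AddSubgroup.comap
        (cohomologyMap (coindFinPull (W.torsionGaloisModule ((p : ℤ) ^ k)).toTopRep (κ.layerSubgroup n)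
          (resGalOfEmb (closureEmb (K := ℚ) (v.adicCompletion ℚ))) (X' := localRepOf (W.torsionGaloisModule ((p : ℤ) ^ k)) v)
          (TopRep.ofHom ⟨ContinuousLinearMap.id ℤ (W.geomTorsion ((p : ℤ) ^ k)), fun _ => rfl⟩) (layerGroup κ v n)
          (fun _ h => h)) 1).hom.toLinearMap.toAddMonoidHom
        (AddSubgroup.map (layerShapiroOf (W.torsionGaloisModule ((p : ℤ) ^ k)) κ v n).toAddMonoidHom
          (cohomologyMap (subgroupRepMap
            (ContinuousRep.mkQHom (GaloisRep.restrictField (v.adicCompletion ℚ) (W.torsionGaloisModule ((p : ℤ) ^ k)))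
              (AddSubgroup.toIntSubmodule (W.kernelOfReductionLocalDatumTorsion ((p : ℤ) ^ k) v).plus)
              (plus_toIntSubmodule_le_comap W ((p : ℤ) ^ k) v)) (layerGroup κ v n)) 1).hom.toLinearMap.toAddMonoidHom.ker))
    (σ : absoluteGaloisGroup ℚ) :
    W.conjH1 p κ.kerSubgroup σ (W.layerToInfty κ n
        (resH1Hom (N := W.geomPrimaryTorsion p) (subgroupInclusion (le_refl (κ.layerSubgroup n)))
          (AddSubgroup.inclusion (AcSigned.geomTorsion_zpow_le_geomPrimaryTorsion W p k)) (fun _ _ ↦ rfl) c)) ∈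
      W.localKerOver p κ.kerSubgroup (v.adicCompletion ℚ) := by
  refine conjH1_realiser_mem_localKerOver_of_mem_strictKer W p κ hκ n k v hpv hgood c ?_ σ
  obtain ⟨x, hx, hxe⟩ := AddSubgroup.mem_map.mp (AddSubgroup.mem_comap.mp hc)
  have hx' : cohomologyMap (subgroupRepMap
      (ContinuousRep.mkQHom (GaloisRep.restrictField (v.adicCompletion ℚ) (W.torsionGaloisModule ((p : ℤ) ^ k)))
        (AddSubgroup.toIntSubmodule (W.kernelOfReductionLocalDatumTorsion ((p : ℤ) ^ k) v).plus)
        (plus_toIntSubmodule_le_comap W ((p : ℤ) ^ k) v)) (layerGroup κ v n)) 1 x = 0 :=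
    (AddMonoidHom.mem_ker).mp hx
  -- `pull_p (loc_p (Sh c)) = Sh_loc (loc_n c)`
  have hpull := ThetaTransport.CoindShapiroOfFun.cohomologyMap_coindFinPull_localization_shapiroLift
    (W.torsionGaloisModule ((p : ℤ) ^ k)) κ v hκ hpv n hs hs1 c
  have hxe' : layerShapiroOf (W.torsionGaloisModule ((p : ℤ) ^ k)) κ v n x =
      layerShapiroOf (W.torsionGaloisModule ((p : ℤ) ^ k)) κ v n (layerLocOf (W.torsionGaloisModule ((p : ℤ) ^ k)) κ v n c) := by
    rw [← hpull]
    exact hxe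
  have hxc : x = layerLocOf (W.torsionGaloisModule ((p : ℤ) ^ k)) κ v n c :=
    shapiroLift_injective (localRepOf (W.torsionGaloisModule ((p : ℤ) ^ k)) v) (layerGroup κ v n) (isOpen_layerGroup κ v n)
      (layerReps_spec κ v n) (layerReps_one κ v n) hxe'
  rw [hxc] at hx'
  exact mem_strictKer_of_cohomologyMap_mkQHom_layerLocOf_eq_zero W ((p : ℤ) ^ k) κ n v c hx'

end HP

end TorsionEulerChar.H46AtP

end Summit.BirchSwinnertonDyer.BirchSwinnertonDyer.Theorems

end
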